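import Summits.QuantumFields.BalabanUV.Beta.GAN24.FaceChargeCurlResummation
import Summits.QuantumFields.BalabanUV.Beta.SpineRecursiveW

/-!
# `BalabanUV.Beta.GAN24.WilsonLetterFlatCharges` — binder row G-an2-4 ∕ (CONV-C), (S) row of RULING R-gan24p1-g27-1 B (viii), the Ward-type half (W-γ) (p2 g39∕g40), PART 7b:
# **THE WILSON LETTER ON THE WHOLE FLAT CLASS 𝒞 = span{1_a, exit_a} ⊗ span{1_b, exit_b}** — per letter `(κ′,u)` and channel `(a,b)`:
# plain ⊗ plain ≡ 0 at EVERY slot; exit_a ⊗ plain_b and plain_a ⊗ exit_b are `−¼·d*d` of the `u`-free forms `2ψ_a•dz x_b` ∕ `2x_a•dzψ_b`, hence, resummed against ANY ℓ¹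
# read-vector `r`, equal `−Σ'_x 𝟙^{exit}_a(x)·(curv r) a b x` ∕ `−Σ'_x 𝟙^{exit}_b(x)·(curv r) a b x` (the curl total over the plaquettes based on ONE face); with PART 7's
# exit ⊗ exit (`−Σ'` over the EDGE plaquettes) every cross-direction (`a ≠ b`) 𝒞-charge of the Wilson letter against an EXACT read-vector VANISHES, and every
# same-direction 𝒞-charge vanishes PER LETTER (exit⊗exit by PART 6; plain⊗plain and both mixed channels here)
# (G-an2-4 formalisation swarm → CRUX TEAM (2), seat `b2b-balaban-gan24-formalise-leaf-02`, gen 55)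

NOT IN PRINT; OUR BOOKKEEPING ([folklore] the `dψ`-law `ContactOneGaugeCellAlgebra.tsum_dz_mul_wilsonA` at the COORDINATE `ψ = x_b` (whose derivative is the unit constant
`b`-form), PART 6∕7's `d*d` bookkeeping and adjointness BY NAME; 0 `def`, 0 cited fact, 0 `def … : Prop`, 0 sorry).  HONEST FRAMING (cell contract, verbatim): «discharging
`BetaPertH` makes Bałaban's UV stability UNCONDITIONAL — a real constructive-QFT result; it is NOT the continuum limit and NOT the Clay problem.»  HONEST DEPENDENCY (verbatim):
«continuum YM on T⁴ ⇐ BetaPertH ∧ nine spine estimates (0/9 proved); BetaPertH ⇐ (D1) ∧ (D4) ∧ CAP+tail; G-an2-4 gates asym, D1 and NE2/3/4.»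

* §1 `dz_coordFn` (`dz x_c κ x = 𝟙[κ = c]`); **`tsum_tsum_exitFace_wilsonA_eq_neg_quarter_curvAdj`** (exit_a ⊗ plain_b: `Σ'_z Σ'_x 𝟙^{exit}_a(x)·W = −¼(d*d n_{ab})_{κ′}(u)`,
  `n_{ab} β z := dz x_b β z·(ψ_a z + ψ_a(z+e_β))`); **`tsum_exitFace_tsum_wilsonA_eq_neg_quarter_curvAdj`** (plain_a ⊗ exit_b: `−¼(d*d n′_{ab})`, `n′_{ab} β z := dzψ_b β z·(z_a + (z+e_β)_a)`);
  **`tsum_tsum_wilsonA_eq_zero`** (plain ⊗ plain ≡ 0 at every slot, every `(a,b)`).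
* §2 `sum_sum_mul_ite_ite`, `sum_sum_curv_mul_wedge` (the pointwise pairing `Σ_κ Σ_l (curv r) κ l x·2c(𝟙[κ=a]𝟙[l=b] − 𝟙[l=a]𝟙[κ=b]) = 4c·(curv r) a b x`),
  **`curv_mixForm`**, **`curv_mixForm'`** (`a ≠ b`: both curvatures are `2·𝟙^{exit}(x)·(𝟙[κ=a]𝟙[l=b] − 𝟙[l=a]𝟙[κ=b])`, the face being `a` resp. `b`).
* §3 `tsum_sum_mul_eq_neg_tsum_of_quarter` (generic resummation), **`tsum_sum_mul_exitPlain_wilsonA_eq_neg_tsum_faceCurl`**, **`tsum_sum_mul_plainExit_wilsonA_eq_neg_tsum_faceCurl`** (`a ≠ b`, `1 ≤ L`, `∀ κ, Summable |r κ ·|`): the resummed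
  mixed charges are `−Σ'_x 𝟙[x_a % L = L−1]·(curv r) a b x` resp. `−Σ'_x 𝟙[x_b % L = L−1]·(curv r) a b x`; `tsum_sum_mul_mixed_wilsonA_eq_zero_of_exact` (`r = dz λ`, `λ ∈ ℓ¹` ⇒ both `0`).
* §3b `curv_axialForm_eq_zero`, **`tsum_tsum_exitFace_wilsonA_same`**, **`tsum_exitFace_tsum_wilsonA_same`** (same direction: both mixed channels ≡ 0 per letter).
* §4 the junction with road-P2's slot tables: `spureRecAt_zero_inl_inl` (the ff block of `SpureRecAt … 0` IS `cE •` the Wilson letter — `vhSAt`'s ff block is `0`),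
  `tsum_tsum_spureRecAt_zero_inl_inl` (no plain⊗plain ff charge at any slot); the other channels of `S_0` are `cE ×` the Wilson ones.
Asserts NO value of any read vector; NOTHING of (W-γ) ∕ (T-F) ∕ (INV) ∕ (S) claimed; NEVER «G-an2-4 closed» as (CONV-C); NOT D1, NOT `BetaPertH`, NOT continuum, NOT Clay.  2026-08-22.
-/

noncomputable section

open Finset
open scoped BigOperators
open Literature.MathematicalPhysics.QuantumFieldTheory.Balaban1983to89
open Literature.MathematicalPhysics.QuantumFieldTheory.Balaban1983to89.Beta
open StepJetData (wilsonA)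
open AffineAveraging (Form1 Form2 dz curv curvAdj curv_dz unitVec unitVec_apply)
open KKTFluctuationKernel (delta1)
open Summit.QuantumFields.BalabanUV.Beta.GAN24.ContactOneGaugeCellAlgebra (tsum_dz_mul_wilsonA affine_unitVec_eq)
open Summit.QuantumFields.BalabanUV.Beta.GAN24.ContactOneGaugeCellMaxwell (tsum_mul_curvAdj_curv_delta1)
open Summit.QuantumFields.BalabanUV.Beta.GAN24.SymLinKernelFaceSupport (exitFace_eq_dz_blk dz_blk_of_ne)
open Summit.QuantumFields.BalabanUV.Beta.GAN24.WilsonLetterFaceCharge (tsum_exitFace_mul_wilsonA curvAdj_curv_sub_smul)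
open Summit.QuantumFields.BalabanUV.Beta.GAN24.FaceChargeCurlResummation (curv_smul_fun_dz tsum_mul_curvAdj_eq_tsum_curv_mul dz_blk_eq_ite
  abs_dz_blk_le_one summable_abs_dz_of_summable)
open Summit.QuantumFields.BalabanUV.Beta.SpineRooted (SpureRecAt SpureRecAt_zero_level)

namespace Summit.QuantumFields.BalabanUV.Beta.GAN24.WilsonLetterFlatCharges

variable {d : ℕ}

/-! ## §1 The mixed and the plain channels per letter -/
/-- [folklore] The derivative of a coordinate function is the unit constant form: `dz x_c κ x = 𝟙[κ = c]`. -/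
theorem dz_coordFn (c κ : Fin (d + 1)) (x : Fin (d + 1) → ℤ) :
    dz (fun z : Fin (d + 1) → ℤ => ((z c : ℤ) : ℝ)) κ x = if κ = c then (1 : ℝ) else 0 := by
  by_cases h : κ = c
  · subst h; simp [AffineAveraging.dz, unitVec_apply]
  · rw [if_neg h]; simp [AffineAveraging.dz, unitVec_apply, Ne.symm h]

/-- [folklore] **THE PLAIN FIRST LEG** `Σ'_x W κ′ u x z (inl a)(inl b) = ½((u+e_κ′)_a − ½(z_a + (z+e_b)_a))·(d*dδ_{(κ′,u)})_b(z)` (the `dψ`-law at `x_a`). -/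
theorem tsum_wilsonA_first_leg (κ' : Fin (d + 1)) (u : Fin (d + 1) → ℤ) (a b : Fin (d + 1)) : ∀ z : Fin (d + 1) → ℤ,
    ∑' x, wilsonA d κ' u x z (Sum.inl a) (Sum.inl b) = (1 / 2 : ℝ) * ((((u + B6BondElimination.unitVec κ') a : ℤ) : ℝ)
      - ((((z a : ℤ) : ℝ)) + (((z + B6BondElimination.unitVec b) a : ℤ) : ℝ)) / 2) * curvAdj (curv (delta1 κ' u)) b z := by
  intro z
  have h := tsum_dz_mul_wilsonA κ' u z b (fun w : Fin (d + 1) → ℤ => ((w a : ℤ) : ℝ))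
  have hpt : ∀ x : Fin (d + 1) → ℤ, ∑ α, dz (fun w : Fin (d + 1) → ℤ => ((w a : ℤ) : ℝ)) α x * wilsonA d κ' u x z (Sum.inl α) (Sum.inl b)
      = wilsonA d κ' u x z (Sum.inl a) (Sum.inl b) := by
    intro x
    rw [Finset.sum_eq_single a, dz_coordFn, if_pos rfl, one_mul]
    · intro α _ hα; rw [dz_coordFn, if_neg hα, zero_mul]
    · exact fun h => absurd (Finset.mem_univ a) h
  rwa [tsum_congr hpt] at h

/-- NOT IN PRINT; OUR BOOKKEEPING.  **exit_a ⊗ plain_b PER LETTER**: `Σ'_z Σ'_x 𝟙^{exit}_a(x)·W κ′ u x z (inl a)(inl b) = −¼·(d*d n_{ab})_{κ′}(u)`,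
`n_{ab} β z := (dz x_b) β z·(ψ_a z + ψ_a(z+e_β))` (PART 6 §2 with the weight `1 = dz x_b` on the second leg). -/
theorem tsum_tsum_exitFace_wilsonA_eq_neg_quarter_curvAdj {L : ℕ} (hL : 1 ≤ L) (κ' : Fin (d + 1)) (u : Fin (d + 1) → ℤ) (a b : Fin (d + 1)) :
    ∑' z, ∑' x, (if x a % (L : ℤ) = (L : ℤ) - 1 then (1 : ℝ) else 0) * wilsonA d κ' u x z (Sum.inl a) (Sum.inl b)
      = -(1 / 4 : ℝ) * curvAdj (curv (fun β z => dz (fun w : Fin (d + 1) → ℤ => ((w b : ℤ) : ℝ)) β z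
          * ((((z a / (L : ℤ) : ℤ) : ℝ)) + (((z + B6BondElimination.unitVec β) a / (L : ℤ) : ℤ) : ℝ)))) κ' u := by
  set cu : ℝ := ((((u + B6BondElimination.unitVec κ') a / (L : ℤ) : ℤ) : ℝ)) with hcu
  have h1 : ∑' z, ∑' x, (if x a % (L : ℤ) = (L : ℤ) - 1 then (1 : ℝ) else 0) * wilsonA d κ' u x z (Sum.inl a) (Sum.inl b)
      = curvAdj (curv (fun β z => dz (fun w : Fin (d + 1) → ℤ => ((w b : ℤ) : ℝ)) β z
          * ((1 / 2 : ℝ) * (cu - ((((z a / (L : ℤ) : ℤ) : ℝ)) + ((((z + B6BondElimination.unitVec β) a / (L : ℤ) : ℤ) : ℝ))) / 2)))) κ' u := by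
    rw [← tsum_mul_curvAdj_curv_delta1]
    refine tsum_congr fun z => ?_
    rw [tsum_exitFace_mul_wilsonA hL, Finset.sum_eq_single b]
    · rw [dz_coordFn, if_pos rfl]; ring
    · intro β _ hβ
      rw [dz_coordFn, if_neg hβ, zero_mul, zero_mul]
    · exact fun h => absurd (Finset.mem_univ b) h
  rw [h1]
  have e : (fun β z => dz (fun w : Fin (d + 1) → ℤ => ((w b : ℤ) : ℝ)) β z
        * ((1 / 2 : ℝ) * (cu - ((((z a / (L : ℤ) : ℤ) : ℝ)) + (((z + B6BondElimination.unitVec β) a / (L : ℤ) : ℤ) : ℝ)) / 2)))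
      = fun β z => (cu / 2) * dz (fun w : Fin (d + 1) → ℤ => ((w b : ℤ) : ℝ)) β z
        - (1 / 4 : ℝ) * (dz (fun w : Fin (d + 1) → ℤ => ((w b : ℤ) : ℝ)) β z
          * ((((z a / (L : ℤ) : ℤ) : ℝ)) + (((z + B6BondElimination.unitVec β) a / (L : ℤ) : ℤ) : ℝ))) := by
    funext β z; ring
  rw [e, curvAdj_curv_sub_smul]
  have h0 : curvAdj (curv (dz (fun w : Fin (d + 1) → ℤ => ((w b : ℤ) : ℝ)))) κ' u = 0 := by
    have hc : curv (dz (fun w : Fin (d + 1) → ℤ => ((w b : ℤ) : ℝ))) = 0 := curv_dz _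
    rw [hc]; simp [AffineAveraging.curvAdj]
  rw [h0]; ring

/-- NOT IN PRINT; OUR BOOKKEEPING.  **plain_a ⊗ exit_b PER LETTER**: `Σ'_z 𝟙^{exit}_b(z)·Σ'_x W κ′ u x z (inl a)(inl b) = −¼·(d*d n′_{ab})_{κ′}(u)`, `n′_{ab} β z := dzψ_b β z·(z_a + (z+e_β)_a)`. -/
theorem tsum_exitFace_tsum_wilsonA_eq_neg_quarter_curvAdj {L : ℕ} (hL : 1 ≤ L) (κ' : Fin (d + 1)) (u : Fin (d + 1) → ℤ) (a b : Fin (d + 1)) :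
    ∑' z, (if z b % (L : ℤ) = (L : ℤ) - 1 then (1 : ℝ) else 0) * ∑' x, wilsonA d κ' u x z (Sum.inl a) (Sum.inl b)
      = -(1 / 4 : ℝ) * curvAdj (curv (fun β z => dz (fun w : Fin (d + 1) → ℤ => ((w b / (L : ℤ) : ℤ) : ℝ)) β z
          * ((((z a : ℤ) : ℝ)) + (((z + B6BondElimination.unitVec β) a : ℤ) : ℝ)))) κ' u := by
  set cu : ℝ := (((u + B6BondElimination.unitVec κ') a : ℤ) : ℝ) with hcu
  -- first leg: the coordinate `ψ = x_a` collapses the channel sum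
  have hx := tsum_wilsonA_first_leg κ' u a b
  have h1 : ∑' z, (if z b % (L : ℤ) = (L : ℤ) - 1 then (1 : ℝ) else 0) * ∑' x, wilsonA d κ' u x z (Sum.inl a) (Sum.inl b)
      = curvAdj (curv (fun β z => dz (fun w : Fin (d + 1) → ℤ => ((w b / (L : ℤ) : ℤ) : ℝ)) β z
          * ((1 / 2 : ℝ) * (cu - ((((z a : ℤ) : ℝ)) + (((z + B6BondElimination.unitVec β) a : ℤ) : ℝ)) / 2)))) κ' u := by
    rw [← tsum_mul_curvAdj_curv_delta1]
    refine tsum_congr fun z => ?_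
    rw [hx z, Finset.sum_eq_single b]
    · rw [← exitFace_eq_dz_blk hL]; ring
    · intro β _ hβ
      rw [dz_blk_of_ne b hβ, zero_mul, zero_mul]
    · exact fun h => absurd (Finset.mem_univ b) h
  rw [h1]
  have e : (fun β z => dz (fun w : Fin (d + 1) → ℤ => ((w b / (L : ℤ) : ℤ) : ℝ)) β z
        * ((1 / 2 : ℝ) * (cu - ((((z a : ℤ) : ℝ)) + (((z + B6BondElimination.unitVec β) a : ℤ) : ℝ)) / 2)))
      = fun β z => (cu / 2) * dz (fun w : Fin (d + 1) → ℤ => ((w b / (L : ℤ) : ℤ) : ℝ)) β z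
        - (1 / 4 : ℝ) * (dz (fun w : Fin (d + 1) → ℤ => ((w b / (L : ℤ) : ℤ) : ℝ)) β z
          * ((((z a : ℤ) : ℝ)) + (((z + B6BondElimination.unitVec β) a : ℤ) : ℝ))) := by
    funext β z; ring
  rw [e, curvAdj_curv_sub_smul]
  have h0 : curvAdj (curv (dz (fun w : Fin (d + 1) → ℤ => ((w b / (L : ℤ) : ℤ) : ℝ)))) κ' u = 0 := by
    have hc : curv (dz (fun w : Fin (d + 1) → ℤ => ((w b / (L : ℤ) : ℤ) : ℝ))) = 0 := by
      have := curv_dz (fun w : Fin (d + 1) → ℤ => ((w b / (L : ℤ) : ℤ) : ℝ))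
      simpa only [affine_unitVec_eq] using this
    rw [hc]; simp [AffineAveraging.curvAdj]
  rw [h0]; ring

/-- NOT IN PRINT; OUR BOOKKEEPING.  **plain ⊗ plain ≡ 0 AT EVERY SLOT, EVERY CHANNEL**: `Σ'_z Σ'_x W κ′ u x z (inl a)(inl b) = 0` — the letter sum is `−¼·d*d` of
`dz x_b β z·(z_a + (z+e_β)_a)`: for `a ≠ b` the form `2x_a • dz x_b` has the CONSTANT curvature `2·dx_a ∧ dx_b` (`curvAdj` of a constant is `0`); for `a = b` it is `dz(x_b²)`. -/
theorem tsum_tsum_wilsonA_eq_zero (κ' : Fin (d + 1)) (u : Fin (d + 1) → ℤ) (a b : Fin (d + 1)) :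
    ∑' z, ∑' x, wilsonA d κ' u x z (Sum.inl a) (Sum.inl b) = 0 := by
  set cu : ℝ := (((u + B6BondElimination.unitVec κ') a : ℤ) : ℝ) with hcu
  have hx := tsum_wilsonA_first_leg κ' u a b
  have h1 : ∑' z, ∑' x, wilsonA d κ' u x z (Sum.inl a) (Sum.inl b)
      = curvAdj (curv (fun β z => dz (fun w : Fin (d + 1) → ℤ => ((w b : ℤ) : ℝ)) β z
          * ((1 / 2 : ℝ) * (cu - ((((z a : ℤ) : ℝ)) + (((z + B6BondElimination.unitVec β) a : ℤ) : ℝ)) / 2)))) κ' u := by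
    rw [← tsum_mul_curvAdj_curv_delta1]
    refine tsum_congr fun z => ?_
    rw [hx z, Finset.sum_eq_single b]
    · rw [dz_coordFn, if_pos rfl]; ring
    · intro β _ hβ
      rw [dz_coordFn, if_neg hβ, zero_mul, zero_mul]
    · exact fun h => absurd (Finset.mem_univ b) h
  rw [h1]
  have e : (fun β z => dz (fun w : Fin (d + 1) → ℤ => ((w b : ℤ) : ℝ)) β z
        * ((1 / 2 : ℝ) * (cu - ((((z a : ℤ) : ℝ)) + (((z + B6BondElimination.unitVec β) a : ℤ) : ℝ)) / 2)))
      = fun β z => (cu / 2) * dz (fun w : Fin (d + 1) → ℤ => ((w b : ℤ) : ℝ)) β z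
        - (1 / 4 : ℝ) * (dz (fun w : Fin (d + 1) → ℤ => ((w b : ℤ) : ℝ)) β z
          * ((((z a : ℤ) : ℝ)) + (((z + B6BondElimination.unitVec β) a : ℤ) : ℝ))) := by
    funext β z; ring
  rw [e, curvAdj_curv_sub_smul]
  have h0 : curvAdj (curv (dz (fun w : Fin (d + 1) → ℤ => ((w b : ℤ) : ℝ)))) κ' u = 0 := by
    rw [curv_dz]; simp [AffineAveraging.curvAdj]
  -- the second form: `curv` is the constant `2(δ^{ab} − δ^{ba})` for `a ≠ b`, and `0` for `a = b`; either way `curvAdj` kills it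
  have hP : curvAdj (curv (fun β z => dz (fun w : Fin (d + 1) → ℤ => ((w b : ℤ) : ℝ)) β z
      * ((((z a : ℤ) : ℝ)) + (((z + B6BondElimination.unitVec β) a : ℤ) : ℝ)))) κ' u = 0 := by
    by_cases hab : a = b
    · subst hab
      have e2 : (fun β z => dz (fun w : Fin (d + 1) → ℤ => ((w a : ℤ) : ℝ)) β z * ((((z a : ℤ) : ℝ)) + (((z + B6BondElimination.unitVec β) a : ℤ) : ℝ)))
          = dz (fun w : Fin (d + 1) → ℤ => (((w a : ℤ) : ℝ)) ^ 2) := by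
        funext β z
        simp only [AffineAveraging.dz, affine_unitVec_eq]
        ring
      rw [e2, curv_dz]; simp [AffineAveraging.curvAdj]
    · have e2 : (fun β z => dz (fun w : Fin (d + 1) → ℤ => ((w b : ℤ) : ℝ)) β z * ((((z a : ℤ) : ℝ)) + (((z + B6BondElimination.unitVec β) a : ℤ) : ℝ)))
          = fun β z => (2 * (((z a : ℤ) : ℝ))) * dz (fun w : Fin (d + 1) → ℤ => ((w b : ℤ) : ℝ)) β z := by
        funext β z
        by_cases hβ : β = b
        · subst hβ
          have : (z + B6BondElimination.unitVec β) a = z a := by rw [← affine_unitVec_eq]; simp [unitVec_apply, hab]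
          rw [this]; ring
        · rw [dz_coordFn, if_neg hβ, zero_mul, mul_zero]
      rw [e2, show (fun β z => (2 * (((z a : ℤ) : ℝ))) * dz (fun w : Fin (d + 1) → ℤ => ((w b : ℤ) : ℝ)) β z)
            = fun β z => (fun y : Fin (d + 1) → ℤ => 2 * (((y a : ℤ) : ℝ))) z * dz (fun w : Fin (d + 1) → ℤ => ((w b : ℤ) : ℝ)) β z from rfl]
      have hc : ∀ κ l x, curv (fun β z => (fun y : Fin (d + 1) → ℤ => 2 * (((y a : ℤ) : ℝ))) z * dz (fun w : Fin (d + 1) → ℤ => ((w b : ℤ) : ℝ)) β z) κ l x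
          = 2 * ((if κ = a then (1 : ℝ) else 0) * (if l = b then (1 : ℝ) else 0) - (if l = a then (1 : ℝ) else 0) * (if κ = b then (1 : ℝ) else 0)) := by
        intro κ l x
        rw [curv_smul_fun_dz, dz_coordFn, dz_coordFn]
        have hd : ∀ (μ : Fin (d + 1)) (y : Fin (d + 1) → ℤ), dz (fun y : Fin (d + 1) → ℤ => 2 * (((y a : ℤ) : ℝ))) μ y = 2 * (if μ = a then (1 : ℝ) else 0) := by
          intro μ y; rw [← dz_coordFn a μ y]; simp only [AffineAveraging.dz]; ring
        rw [hd, hd]; ring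
      have hconst : curv (fun β z => (fun y : Fin (d + 1) → ℤ => 2 * (((y a : ℤ) : ℝ))) z * dz (fun w : Fin (d + 1) → ℤ => ((w b : ℤ) : ℝ)) β z)
          = fun κ l _ => 2 * ((if κ = a then (1 : ℝ) else 0) * (if l = b then (1 : ℝ) else 0) - (if l = a then (1 : ℝ) else 0) * (if κ = b then (1 : ℝ) else 0)) := by
        funext κ l x; exact hc κ l x
      rw [hconst]
      simp only [AffineAveraging.curvAdj, sub_self, Finset.sum_const_zero, add_zero]
  rw [h0, hP]; ring

/-! ## §2 The curvatures of the mixed forms and their pointwise pairings -/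
/-- [folklore] A double finite sum against two Kronecker indicators picks one entry. -/
theorem sum_sum_mul_ite_ite (f : Fin (d + 1) → Fin (d + 1) → ℝ) (a b : Fin (d + 1)) :
    ∑ κ, ∑ l, f κ l * ((if κ = a then (1 : ℝ) else 0) * (if l = b then (1 : ℝ) else 0)) = f a b := by
  rw [Finset.sum_eq_single a, Finset.sum_eq_single b]
  · simp
  · intro l _ hl; simp [hl]
  · exact fun h => absurd (Finset.mem_univ b) h
  · exact fun κ _ hκ => Finset.sum_eq_zero fun l _ => by simp [hκ]
  · exact fun h => absurd (Finset.mem_univ a) h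

/-- [folklore] **THE POINTWISE PAIRING AGAINST A WEDGE**: `Σ_κ Σ_l (curv r) κ l x·(2c·(𝟙[κ=a]𝟙[l=b] − 𝟙[l=a]𝟙[κ=b])) = 4c·(curv r) a b x` (`curv r b a = −curv r a b`). -/
theorem sum_sum_curv_mul_wedge (r : Form1 (d + 1) ℝ) (a b : Fin (d + 1)) (c : ℝ) (x : Fin (d + 1) → ℤ) :
    ∑ κ, ∑ l, curv r κ l x * (2 * c * ((if κ = a then (1 : ℝ) else 0) * (if l = b then (1 : ℝ) else 0)
        - (if l = a then (1 : ℝ) else 0) * (if κ = b then (1 : ℝ) else 0))) = 4 * c * curv r a b x := by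
  have e : ∀ κ l, curv r κ l x * (2 * c * ((if κ = a then (1 : ℝ) else 0) * (if l = b then (1 : ℝ) else 0)
        - (if l = a then (1 : ℝ) else 0) * (if κ = b then (1 : ℝ) else 0)))
      = 2 * c * (curv r κ l x * ((if κ = a then (1 : ℝ) else 0) * (if l = b then (1 : ℝ) else 0)))
        - 2 * c * (curv r κ l x * ((if κ = b then (1 : ℝ) else 0) * (if l = a then (1 : ℝ) else 0))) := by
    intro κ l; ring
  simp only [e, Finset.sum_sub_distrib, ← Finset.mul_sum]
  rw [sum_sum_mul_ite_ite (fun κ l => curv r κ l x) a b, sum_sum_mul_ite_ite (fun κ l => curv r κ l x) b a]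
  have hanti : curv r b a x = -curv r a b x := by simp only [AffineAveraging.curv]; ring
  rw [hanti]; ring

/-- NOT IN PRINT; OUR BOOKKEEPING.  **CURVATURE OF THE exit_a ⊗ plain_b FORM** (`a ≠ b`): `n_{ab} = 2ψ_a • dz x_b`, `curv n_{ab} κ l x = 2·𝟙^{exit}_a(x)·(𝟙[κ=a]𝟙[l=b] − 𝟙[l=a]𝟙[κ=b])`. -/
theorem curv_mixForm {L : ℕ} (hL : 1 ≤ L) {a b : Fin (d + 1)} (hab : a ≠ b) (κ l : Fin (d + 1)) (x : Fin (d + 1) → ℤ) :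
    curv (fun β z => dz (fun w : Fin (d + 1) → ℤ => ((w b : ℤ) : ℝ)) β z
        * ((((z a / (L : ℤ) : ℤ) : ℝ)) + (((z + B6BondElimination.unitVec β) a / (L : ℤ) : ℤ) : ℝ))) κ l x
      = 2 * (if x a % (L : ℤ) = (L : ℤ) - 1 then (1 : ℝ) else 0)
          * ((if κ = a then (1 : ℝ) else 0) * (if l = b then (1 : ℝ) else 0) - (if l = a then (1 : ℝ) else 0) * (if κ = b then (1 : ℝ) else 0)) := by
  have e : (fun β z => dz (fun w : Fin (d + 1) → ℤ => ((w b : ℤ) : ℝ)) β z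
        * ((((z a / (L : ℤ) : ℤ) : ℝ)) + (((z + B6BondElimination.unitVec β) a / (L : ℤ) : ℤ) : ℝ)))
      = fun β z => (fun y : Fin (d + 1) → ℤ => 2 * (((y a / (L : ℤ) : ℤ) : ℝ))) z * dz (fun w : Fin (d + 1) → ℤ => ((w b : ℤ) : ℝ)) β z := by
    funext β z
    by_cases hβ : β = b
    · subst hβ
      have : (z + B6BondElimination.unitVec β) a = z a := by rw [← affine_unitVec_eq]; simp [unitVec_apply, hab]
      rw [this, dz_coordFn, if_pos rfl]; ring
    · rw [dz_coordFn, if_neg hβ, zero_mul, mul_zero]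
  rw [e, curv_smul_fun_dz, dz_coordFn, dz_coordFn]
  have hd : ∀ (μ : Fin (d + 1)) (y : Fin (d + 1) → ℤ), dz (fun y : Fin (d + 1) → ℤ => 2 * (((y a / (L : ℤ) : ℤ) : ℝ))) μ y
      = 2 * dz (fun w : Fin (d + 1) → ℤ => ((w a / (L : ℤ) : ℤ) : ℝ)) μ y := by
    intro μ y; simp only [AffineAveraging.dz]; ring
  rw [hd, hd, dz_blk_eq_ite hL a κ x, dz_blk_eq_ite hL a l x]
  by_cases hκ : κ = a
  · subst hκ
    by_cases hl : l = κ
    · subst hl; simp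
    · rw [if_pos rfl, if_neg hl, if_pos rfl, if_neg hl]; ring
  · rw [if_neg hκ, if_neg hκ]
    by_cases hl : l = a
    · subst hl; rw [if_pos rfl, if_pos rfl]; ring
    · rw [if_neg hl, if_neg hl]; ring

/-- NOT IN PRINT; OUR BOOKKEEPING.  **CURVATURE OF THE plain_a ⊗ exit_b FORM** (`a ≠ b`): `n′_{ab} = 2x_a • dzψ_b`, `curv n′_{ab} κ l x = 2·𝟙^{exit}_b(x)·(𝟙[κ=a]𝟙[l=b] − 𝟙[l=a]𝟙[κ=b])`. -/
theorem curv_mixForm' {L : ℕ} (hL : 1 ≤ L) {a b : Fin (d + 1)} (hab : a ≠ b) (κ l : Fin (d + 1)) (x : Fin (d + 1) → ℤ) :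
    curv (fun β z => dz (fun w : Fin (d + 1) → ℤ => ((w b / (L : ℤ) : ℤ) : ℝ)) β z
        * ((((z a : ℤ) : ℝ)) + (((z + B6BondElimination.unitVec β) a : ℤ) : ℝ))) κ l x
      = 2 * (if x b % (L : ℤ) = (L : ℤ) - 1 then (1 : ℝ) else 0)
          * ((if κ = a then (1 : ℝ) else 0) * (if l = b then (1 : ℝ) else 0) - (if l = a then (1 : ℝ) else 0) * (if κ = b then (1 : ℝ) else 0)) := by
  have e : (fun β z => dz (fun w : Fin (d + 1) → ℤ => ((w b / (L : ℤ) : ℤ) : ℝ)) β z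
        * ((((z a : ℤ) : ℝ)) + (((z + B6BondElimination.unitVec β) a : ℤ) : ℝ)))
      = fun β z => (fun y : Fin (d + 1) → ℤ => 2 * (((y a : ℤ) : ℝ))) z * dz (fun w : Fin (d + 1) → ℤ => ((w b / (L : ℤ) : ℤ) : ℝ)) β z := by
    funext β z
    by_cases hβ : β = b
    · subst hβ
      have : (z + B6BondElimination.unitVec β) a = z a := by rw [← affine_unitVec_eq]; simp [unitVec_apply, hab]
      rw [this]; ring
    · rw [dz_blk_of_ne b hβ, zero_mul, mul_zero]
  rw [e, curv_smul_fun_dz]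
  have hd : ∀ (μ : Fin (d + 1)) (y : Fin (d + 1) → ℤ), dz (fun y : Fin (d + 1) → ℤ => 2 * (((y a : ℤ) : ℝ))) μ y
      = 2 * (if μ = a then (1 : ℝ) else 0) := by
    intro μ y; rw [← dz_coordFn a μ y]; simp only [AffineAveraging.dz]; ring
  rw [hd, hd]
  have hba : (x + unitVec a) b = x b := by simp [unitVec_apply, hab.symm]
  by_cases hκ : κ = a
  · rw [hκ, if_pos rfl, if_neg hab, dz_blk_of_ne b hab (x + unitVec l), dz_blk_eq_ite hL b l (x + unitVec a), hba]
    split_ifs <;> ring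
  · rw [if_neg hκ]
    by_cases hl : l = a
    · rw [hl, if_pos rfl, if_neg hab, dz_blk_eq_ite hL b κ (x + unitVec a), hba]
      split_ifs <;> ring
    · rw [if_neg hl]; ring

/-! ## §3 The mixed channels resummed against an ℓ¹ read-vector = minus the one-face plaquette-curl total -/
/-- [folklore] **GENERIC RESUMMATION**: if a letter functional is `Z κ′ u = −¼·(d*d n)_{κ′}(u)` with `|curv n| ≤ B` and the pointwise pairing
`Σ_κ Σ_l (curv r) κ l x·(curv n) κ l x = 4·c x·(curv r) a b x`, then for `r` with absolutely summable components `Σ'_u Σ_{κ′} r κ′ u·Z κ′ u = −Σ'_x c x·(curv r) a b x`. -/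
theorem tsum_sum_mul_eq_neg_tsum_of_quarter {Z : Fin (d + 1) → (Fin (d + 1) → ℤ) → ℝ} {n r : Form1 (d + 1) ℝ} {B : ℝ} {c : (Fin (d + 1) → ℤ) → ℝ}
    {a b : Fin (d + 1)} (hZ : ∀ κ' u, Z κ' u = -(1 / 4 : ℝ) * curvAdj (curv n) κ' u) (hB : ∀ κ l x, |curv n κ l x| ≤ B)
    (hpair : ∀ x, ∑ κ, ∑ l, curv r κ l x * curv n κ l x = 4 * c x * curv r a b x) (hr : ∀ κ, Summable fun u => |r κ u|) :
    ∑' u, ∑ κ', r κ' u * Z κ' u = -∑' x, c x * curv r a b x := by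
  have step1 : ∀ u, ∑ κ', r κ' u * Z κ' u = -(1 / 4 : ℝ) * ∑ κ', r κ' u * curvAdj (curv n) κ' u := by
    intro u
    rw [Finset.mul_sum]
    exact Finset.sum_congr rfl fun κ' _ => by rw [hZ]; ring
  rw [tsum_congr step1, tsum_mul_left, tsum_mul_curvAdj_eq_tsum_curv_mul hr hB, tsum_congr hpair]
  have e4 : (fun x => 4 * c x * curv r a b x) = fun x => 4 * (c x * curv r a b x) := by funext x; ring
  rw [e4, tsum_mul_left]; ring

/-- NOT IN PRINT; OUR BOOKKEEPING.  **exit_a ⊗ plain_b RESUMMED** (`a ≠ b`, `1 ≤ L`, `r` with absolutely summable components):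
`Σ'_u Σ_{κ′} r κ′ u·[Σ'_z Σ'_x 𝟙^{exit}_a(x)·W κ′ u x z (inl a)(inl b)] = −Σ'_x 𝟙[x_a % L = L−1]·(curv r) a b x`. -/
theorem tsum_sum_mul_exitPlain_wilsonA_eq_neg_tsum_faceCurl {L : ℕ} (hL : 1 ≤ L) {a b : Fin (d + 1)} (hab : a ≠ b) {r : Form1 (d + 1) ℝ}
    (hr : ∀ κ, Summable fun u => |r κ u|) :
    ∑' u, ∑ κ', r κ' u * (∑' z, ∑' x, (if x a % (L : ℤ) = (L : ℤ) - 1 then (1 : ℝ) else 0) * wilsonA d κ' u x z (Sum.inl a) (Sum.inl b))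
      = -∑' x, (if x a % (L : ℤ) = (L : ℤ) - 1 then (1 : ℝ) else 0) * curv r a b x :=
  tsum_sum_mul_eq_neg_tsum_of_quarter (fun κ' u => tsum_tsum_exitFace_wilsonA_eq_neg_quarter_curvAdj hL κ' u a b)
    (B := 4) (fun κ l x => by rw [curv_mixForm hL hab]; split_ifs <;> norm_num)
    (fun x => by simp only [curv_mixForm hL hab]; exact sum_sum_curv_mul_wedge r a b _ x) hr

/-- NOT IN PRINT; OUR BOOKKEEPING.  **plain_a ⊗ exit_b RESUMMED** (`a ≠ b`, `1 ≤ L`, `r` ℓ¹):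
`Σ'_u Σ_{κ′} r κ′ u·[Σ'_z 𝟙^{exit}_b(z)·Σ'_x W κ′ u x z (inl a)(inl b)] = −Σ'_x 𝟙[x_b % L = L−1]·(curv r) a b x`. -/
theorem tsum_sum_mul_plainExit_wilsonA_eq_neg_tsum_faceCurl {L : ℕ} (hL : 1 ≤ L) {a b : Fin (d + 1)} (hab : a ≠ b) {r : Form1 (d + 1) ℝ}
    (hr : ∀ κ, Summable fun u => |r κ u|) :
    ∑' u, ∑ κ', r κ' u * (∑' z, (if z b % (L : ℤ) = (L : ℤ) - 1 then (1 : ℝ) else 0) * ∑' x, wilsonA d κ' u x z (Sum.inl a) (Sum.inl b))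
      = -∑' x, (if x b % (L : ℤ) = (L : ℤ) - 1 then (1 : ℝ) else 0) * curv r a b x :=
  tsum_sum_mul_eq_neg_tsum_of_quarter (fun κ' u => tsum_exitFace_tsum_wilsonA_eq_neg_quarter_curvAdj hL κ' u a b)
    (B := 4) (fun κ l x => by rw [curv_mixForm' hL hab]; split_ifs <;> norm_num)
    (fun x => by simp only [curv_mixForm' hL hab]; exact sum_sum_curv_mul_wedge r a b _ x) hr

/-- NOT IN PRINT; OUR BOOKKEEPING.  Both mixed channels VANISH against an EXACT read-vector `r = dz λ`, `λ ∈ ℓ¹` (`curv ∘ dz = 0`). -/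
theorem tsum_sum_mul_mixed_wilsonA_eq_zero_of_exact {L : ℕ} (hL : 1 ≤ L) {a b : Fin (d + 1)} (hab : a ≠ b) {lam : (Fin (d + 1) → ℤ) → ℝ}
    (hlam : Summable fun u => |lam u|) :
    ∑' u, ∑ κ', dz lam κ' u * (∑' z, ∑' x, (if x a % (L : ℤ) = (L : ℤ) - 1 then (1 : ℝ) else 0) * wilsonA d κ' u x z (Sum.inl a) (Sum.inl b)) = 0
    ∧ ∑' u, ∑ κ', dz lam κ' u * (∑' z, (if z b % (L : ℤ) = (L : ℤ) - 1 then (1 : ℝ) else 0) * ∑' x, wilsonA d κ' u x z (Sum.inl a) (Sum.inl b)) = 0 := by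
  have h0 : ∀ x, curv (dz lam) a b x = 0 := fun x => by rw [curv_dz]; rfl
  rw [tsum_sum_mul_exitPlain_wilsonA_eq_neg_tsum_faceCurl hL hab (summable_abs_dz_of_summable hlam),
    tsum_sum_mul_plainExit_wilsonA_eq_neg_tsum_faceCurl hL hab (summable_abs_dz_of_summable hlam)]
  simp only [h0, mul_zero, tsum_zero, neg_zero, and_self]

/-! ## §3b Same direction: both mixed channels vanish per letter -/
/-- [folklore] A one-component form whose coefficient depends only on its own coordinate is CLOSED: `curv (β z ↦ 𝟙[β = a]·g(z_a)) = 0`. -/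
theorem curv_axialForm_eq_zero (a : Fin (d + 1)) (g : ℤ → ℝ) (κ l : Fin (d + 1)) (x : Fin (d + 1) → ℤ) :
    curv (fun β (z : Fin (d + 1) → ℤ) => (if β = a then (1 : ℝ) else 0) * g (z a)) κ l x = 0 := by
  have hne : ∀ μ : Fin (d + 1), μ ≠ a → (x + unitVec μ) a = x a := fun μ hμ => by
    rw [Pi.add_apply, unitVec_apply, if_neg (fun h => hμ h.symm), add_zero]
  have heq : (x + unitVec a) a = x a + 1 := by simp [unitVec_apply]
  simp only [AffineAveraging.curv]
  by_cases hκ : κ = a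
  · rw [hκ, if_pos rfl, heq]
    by_cases hl : l = a
    · rw [hl, if_pos rfl, heq]; ring
    · rw [if_neg hl, hne l hl]; ring
  · rw [if_neg hκ, hne κ hκ]; ring

/-- NOT IN PRINT; OUR BOOKKEEPING.  **SAME DIRECTION, exit_a ⊗ plain_a ≡ 0 PER LETTER**: `n_{aa} β z = 𝟙[β = a]·(ψ_a(z_a) + ψ_a(z_a + 1))` is closed (§3b). -/
theorem tsum_tsum_exitFace_wilsonA_same {L : ℕ} (hL : 1 ≤ L) (κ' : Fin (d + 1)) (u : Fin (d + 1) → ℤ) (a : Fin (d + 1)) :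
    ∑' z, ∑' x, (if x a % (L : ℤ) = (L : ℤ) - 1 then (1 : ℝ) else 0) * wilsonA d κ' u x z (Sum.inl a) (Sum.inl a) = 0 := by
  rw [tsum_tsum_exitFace_wilsonA_eq_neg_quarter_curvAdj hL]
  have e : (fun β z => dz (fun w : Fin (d + 1) → ℤ => ((w a : ℤ) : ℝ)) β z
        * ((((z a / (L : ℤ) : ℤ) : ℝ)) + (((z + B6BondElimination.unitVec β) a / (L : ℤ) : ℤ) : ℝ)))
      = fun β (z : Fin (d + 1) → ℤ) => (if β = a then (1 : ℝ) else 0) * (fun t : ℤ => (((t / (L : ℤ) : ℤ) : ℝ)) + ((((t + 1) / (L : ℤ) : ℤ) : ℝ))) (z a) := by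
    funext β z
    rw [dz_coordFn]
    by_cases hβ : β = a
    · subst hβ
      have : (z + B6BondElimination.unitVec β) β = z β + 1 := by rw [← affine_unitVec_eq]; simp [unitVec_apply]
      rw [this, if_pos rfl]
    · rw [if_neg hβ, zero_mul, zero_mul]
  have hc : curv (fun β (z : Fin (d + 1) → ℤ) => (if β = a then (1 : ℝ) else 0)
      * (fun t : ℤ => (((t / (L : ℤ) : ℤ) : ℝ)) + ((((t + 1) / (L : ℤ) : ℤ) : ℝ))) (z a)) = fun _ _ _ => 0 := by
    funext κ l x; exact curv_axialForm_eq_zero a (fun t : ℤ => (((t / (L : ℤ) : ℤ) : ℝ)) + ((((t + 1) / (L : ℤ) : ℤ) : ℝ))) κ l x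
  rw [e, hc]; simp [AffineAveraging.curvAdj]

/-- NOT IN PRINT; OUR BOOKKEEPING.  **SAME DIRECTION, plain_a ⊗ exit_a ≡ 0 PER LETTER**: `n′_{aa} β z = 𝟙[β = a]·𝟙^{exit}_a(z)·(2z_a + 1)` is closed (§3b). -/
theorem tsum_exitFace_tsum_wilsonA_same {L : ℕ} (hL : 1 ≤ L) (κ' : Fin (d + 1)) (u : Fin (d + 1) → ℤ) (a : Fin (d + 1)) :
    ∑' z, (if z a % (L : ℤ) = (L : ℤ) - 1 then (1 : ℝ) else 0) * ∑' x, wilsonA d κ' u x z (Sum.inl a) (Sum.inl a) = 0 := by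
  rw [tsum_exitFace_tsum_wilsonA_eq_neg_quarter_curvAdj hL]
  have e : (fun β z => dz (fun w : Fin (d + 1) → ℤ => ((w a / (L : ℤ) : ℤ) : ℝ)) β z
        * ((((z a : ℤ) : ℝ)) + (((z + B6BondElimination.unitVec β) a : ℤ) : ℝ)))
      = fun β (z : Fin (d + 1) → ℤ) => (if β = a then (1 : ℝ) else 0)
        * (fun t : ℤ => (if t % (L : ℤ) = (L : ℤ) - 1 then (1 : ℝ) else 0) * (((t : ℤ) : ℝ) + (((t + 1 : ℤ) : ℝ)))) (z a) := by
    funext β z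
    by_cases hβ : β = a
    · subst hβ
      have : (z + B6BondElimination.unitVec β) β = z β + 1 := by rw [← affine_unitVec_eq]; simp [unitVec_apply]
      rw [dz_blk_eq_ite hL, if_pos rfl, if_pos rfl, this]; push_cast; ring
    · rw [dz_blk_of_ne a hβ, if_neg hβ, zero_mul, zero_mul]
  have hc : curv (fun β (z : Fin (d + 1) → ℤ) => (if β = a then (1 : ℝ) else 0)
      * (fun t : ℤ => (if t % (L : ℤ) = (L : ℤ) - 1 then (1 : ℝ) else 0) * (((t : ℤ) : ℝ) + (((t + 1 : ℤ) : ℝ)))) (z a)) = fun _ _ _ => 0 := by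
    funext κ l x
    exact curv_axialForm_eq_zero a (fun t : ℤ => (if t % (L : ℤ) = (L : ℤ) - 1 then (1 : ℝ) else 0) * (((t : ℤ) : ℝ) + (((t + 1 : ℤ) : ℝ)))) κ l x
  rw [e, hc]; simp [AffineAveraging.curvAdj]

/-! ## §4 The junction with road-P2's slot tables: at level `0` the ff block of `SpureRecAt` IS `cE •` the Wilson letter (the VH letter has no ff block) -/
/-- [folklore] **THE ff BLOCK OF THE LEVEL-0 PURE S TABLE IS THE WILSON LETTER, SCALED**: `SpureRecAt d Lc ρ cE cVH cΛ 0 κ′ u x z (inl a)(inl b) = cE·W κ′ u x z (inl a)(inl b)`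
(`vhSAt`'s field–field block is `0` by `rfl`). -/
theorem spureRecAt_zero_inl_inl {Lc : ℕ} [NeZero Lc] (ρ : Fin (d + 1) → ℤ) (cE cVH cΛ : ℝ) (κ' : Fin (d + 1)) (u x z : Fin (d + 1) → ℤ) (a b : Fin (d + 1)) :
    SpureRecAt d Lc ρ cE cVH cΛ 0 κ' u x z (Sum.inl a) (Sum.inl b) = cE * wilsonA d κ' u x z (Sum.inl a) (Sum.inl b) := by
  have h : AveragingHessianKernelsRooted.vhSAt ρ d Lc rfl κ' u x z (Sum.inl a) (Sum.inl b) = 0 := rfl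
  simp only [SpureRecAt_zero_level, Pi.add_apply, Pi.smul_apply, smul_eq_mul, h, mul_zero, add_zero]

/-- NOT IN PRINT; OUR BOOKKEEPING.  **THE LEVEL-0 PURE S TABLE HAS NO plain ⊗ plain ff CHARGE AT ANY SLOT**: `Σ'_z Σ'_x SpureRecAt … 0 κ′ u x z (inl a)(inl b) = 0`. -/
theorem tsum_tsum_spureRecAt_zero_inl_inl {Lc : ℕ} [NeZero Lc] (ρ : Fin (d + 1) → ℤ) (cE cVH cΛ : ℝ) (κ' : Fin (d + 1)) (u : Fin (d + 1) → ℤ)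
    (a b : Fin (d + 1)) :
    ∑' z, ∑' x, SpureRecAt d Lc ρ cE cVH cΛ 0 κ' u x z (Sum.inl a) (Sum.inl b) = 0 := by
  simp only [spureRecAt_zero_inl_inl, tsum_mul_left, tsum_tsum_wilsonA_eq_zero, mul_zero]

end Summit.QuantumFields.BalabanUV.Beta.GAN24.WilsonLetterFlatCharges

end
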